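import Mathlib
import Summits.Ventures.PercRepro2.ZMeanProof
import Summits.Ventures.PercRepro2.PendantRoot
import Summits.Ventures.PercRepro2.HMFLeaf
import Summits.Ventures.PercRepro2.HMFLeafStep
import Summits.Ventures.PercRepro2.HMFLeafInvisible
import Summits.Ventures.PercRepro2.HMFLoop
import Summits.Ventures.PercRepro2.HMFLeafRB
import Summits.Ventures.PercRepro2.HMFSureEdge
import Summits.Ventures.PercRepro2.GcTransport
import Summits.Ventures.PercRepro2.StarOKappa
import Summits.Ventures.PercRepro2.StarOMain

/-!
# (HMF) at the contracted instance of the class «a₃ pendant at u, N(u) = {a₁, a₂, o, a₃}»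
(blind cell PercRepro2, night-1 g8; NIGHT1-G8.md §9)

Let `a₃` be a leaf with edge `f = {a₃, u}`, and let `u` carry exactly the edges `f`, `f₁ = {u, a₁}`,
`f₂ = {u, a₂}`, `f₃ = {u, o}`.  With `f` sure and the mark moved to `u` (`HMFSureEdge`), the instance
has the mark `u` with an unmarked leaf `a₃` attached — invisible to `HMFc`
(`HMFLeafInvisible.HMFc_update_leaf`), so the weight of `f` may be set to `0`; pinned closed is
re-routed to a loop at `a₃` (`HMFLoop.HMFc_update_zero_eq_loop`), and in the loop graph `u` carries
exactly the three star edges, so the class-O theorem `StarO.HMF_star_o` applies: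
**`HMF (p[f ↦ 1]) … u …`** (`HMF_contract_star_o`).  This is hypothesis (i) of the leaf step
`HMFLeafStep.HMF_of_leaf_step_relabel` for the class; hypothesis (ii), `κ ≥ 0`, is the
34-coefficient certificate of the κ-leaf table (NIGHT1-G8.md §5, job j232819).
-/

open scoped Classical

namespace Summit.Ventures.PercRepro2

open UnionCluster CovForm PendantRoot RECM HMFLeafInvisible HMFSureEdge StarO

namespace HMFStarLeafO

variable {V : Type*} {E : Type*} [Fintype E] [DecidableEq E] [Fintype V] [DecidableEq V]
  {R : Type*} [Field R] [LinearOrder R] [IsStrictOrderedRing R]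

variable (p : E → R) (ends : E → Sym2 V) {f f₁ f₂ f₃ : E} {a₃ u a₁ a₂ o : V}

omit [Fintype E] [Fintype V] [DecidableEq V] in
/-- In the loop graph the star at `u` is `{f₁, f₂, f₃}`. -/
lemma hstar_loop (hf : ends f = s(a₃, u))
    (hstar : ∀ e, u ∈ ends e → e = f ∨ e = f₁ ∨ e = f₂ ∨ e = f₃) (h3u : a₃ ≠ u) :
    ∀ e, u ∈ (Function.update ends f s(a₃, a₃)) e → e = f₁ ∨ e = f₂ ∨ e = f₃ := by
  intro e he
  by_cases hef : e = f
  · subst hef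
    rw [Function.update_self] at he
    rcases Sym2.mem_iff.1 he with h | h <;> exact absurd h.symm h3u
  · rw [Function.update_of_ne hef] at he
    rcases hstar e he with h | h | h | h
    · exact absurd h hef
    · exact Or.inl h
    · exact Or.inr (Or.inl h)
    · exact Or.inr (Or.inr h)

omit [Fintype E] [Fintype V] [DecidableEq V] in
/-- The loop graph `ends[f ↦ s(a₃, a₃)]` carries the star `{f₁, f₂, f₃}` at `u`. -/
lemma star_loop (hf : ends f = s(a₃, u)) (hf₁ : ends f₁ = s(u, a₁)) (hf₂ : ends f₂ = s(u, a₂))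
    (hf₃ : ends f₃ = s(u, o)) (hstar : ∀ e, u ∈ ends e → e = f ∨ e = f₁ ∨ e = f₂ ∨ e = f₃)
    (h3u : a₃ ≠ u) (h31 : a₃ ≠ a₁) (h32 : a₃ ≠ a₂) (h3o : a₃ ≠ o) :
    (Function.update ends f s(a₃, a₃)) f₁ = s(u, a₁) ∧
      (Function.update ends f s(a₃, a₃)) f₂ = s(u, a₂) ∧
      (Function.update ends f s(a₃, a₃)) f₃ = s(u, o) ∧
      ∀ e, u ∈ (Function.update ends f s(a₃, a₃)) e → e = f₁ ∨ e = f₂ ∨ e = f₃ := by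
  have hff₁ : f ≠ f₁ := by
    intro h; rw [h, hf₁] at hf
    rcases Sym2.eq_iff.1 hf with ⟨h', _⟩ | ⟨_, h'⟩
    · exact h3u h'.symm
    · exact h31 h'.symm
  have hff₂ : f ≠ f₂ := by
    intro h; rw [h, hf₂] at hf
    rcases Sym2.eq_iff.1 hf with ⟨h', _⟩ | ⟨_, h'⟩
    · exact h3u h'.symm
    · exact h32 h'.symm
  have hff₃ : f ≠ f₃ := by
    intro h; rw [h, hf₃] at hf
    rcases Sym2.eq_iff.1 hf with ⟨h', _⟩ | ⟨_, h'⟩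
    · exact h3u h'.symm
    · exact h3o h'.symm
  exact ⟨by rw [Function.update_of_ne (Ne.symm hff₁), hf₁],
    by rw [Function.update_of_ne (Ne.symm hff₂), hf₂],
    by rw [Function.update_of_ne (Ne.symm hff₃), hf₃], hstar_loop ends hf hstar h3u⟩

/-- **(HMF) at the contracted instance with the mark at `u`**: `u` adjacent only to `a₁`, `a₂`, `o`
and the leaf `a₃`; with `f = {a₃, u}` sure, the class-O theorem gives the mean-field row. -/
theorem HMF_contract_star_o (hp : IsProbVec p) (hf : ends f = s(a₃, u))
    (hf₁ : ends f₁ = s(u, a₁)) (hf₂ : ends f₂ = s(u, a₂)) (hf₃ : ends f₃ = s(u, o))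
    (hleaf : ∀ e, a₃ ∈ ends e → e = f)
    (hstar : ∀ e, u ∈ ends e → e = f ∨ e = f₁ ∨ e = f₂ ∨ e = f₃) (h3u : a₃ ≠ u) {b : V}
    (h3o : a₃ ≠ o) (h31 : a₃ ≠ a₁) (h32 : a₃ ≠ a₂) (h3b : a₃ ≠ b) (hu1 : u ≠ a₁) (hu2 : u ≠ a₂)
    (huo : u ≠ o) (hub : u ≠ b) (h12 : a₁ ≠ a₂) (h1o : a₁ ≠ o) (h2o : a₂ ≠ o) :
    HMF (Function.update p f 1) ends o a₁ a₂ u b := by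
  unfold HMF
  -- the unmarked leaf `a₃` is invisible: move the weight of `f` to `0`
  rw [HMFLeafInvisible.HMFc_update_leaf p hf hleaf h3u h3o h31 h32 h3u h3b 1,
    ← HMFLeafInvisible.HMFc_update_leaf p hf hleaf h3u h3o h31 h32 h3u h3b 0,
    HMFLoop.HMFc_update_zero_eq_loop p ends f a₃ o a₁ a₂ u b]
  obtain ⟨hf₁', hf₂', hf₃', hstar'⟩ := star_loop ends hf hf₁ hf₂ hf₃ hstar h3u h31 h32 h3o
  exact StarO.HMF_star_o p (Function.update ends f s(a₃, a₃)) hp hf₁' hf₂' hf₃' hstar' hu1 hu2 huo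
    hub h12 h1o h2o

/-- **(HCOV) at the contracted instance** (from (HMF) by `HCov_of_HMF`). -/
theorem HCov_contract_star_o (hp : IsProbVec p) (hf : ends f = s(a₃, u))
    (hf₁ : ends f₁ = s(u, a₁)) (hf₂ : ends f₂ = s(u, a₂)) (hf₃ : ends f₃ = s(u, o))
    (hleaf : ∀ e, a₃ ∈ ends e → e = f)
    (hstar : ∀ e, u ∈ ends e → e = f ∨ e = f₁ ∨ e = f₂ ∨ e = f₃) (h3u : a₃ ≠ u) {b : V}
    (h3o : a₃ ≠ o) (h31 : a₃ ≠ a₁) (h32 : a₃ ≠ a₂) (h3b : a₃ ≠ b) (hu1 : u ≠ a₁) (hu2 : u ≠ a₂)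
    (huo : u ≠ o) (hub : u ≠ b) (h12 : a₁ ≠ a₂) (h1o : a₁ ≠ o) (h2o : a₂ ≠ o) :
    CovForm.HCov (Function.update p f 1) ends o a₁ a₂ u b :=
  HCov_of_HMF (Function.update p f 1) (hp.update f zero_le_one le_rfl) ends o a₁ a₂ u b
    (HMF_contract_star_o p ends hp hf hf₁ hf₂ hf₃ hleaf hstar h3u h3o h31 h32 h3b hu1 hu2 huo hub
      h12 h1o h2o)

/-- `kappaMassO` of the class-O table of the weights `p` on `ends` at the centre `u`
(`Z₁, A_L, A_H, B_L, B_H, P_LH, P_LL, P_HL, P_HH, P_NH, cob, G_ob, G′_ob, X₀` as in `HMFc_star_o`). -/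
noncomputable def kappaTable (p : E → R) (ends : E → Sym2 V) (u o a₁ a₂ b : V) (al be r : R) : R :=
  kappaMassO
    (prob (pOut p ends u) (avoidAll ends a₂ {a₁}))
    (prob (pOut p ends u) (avoidAll ends a₂ {a₁} ∩ connEvent ends a₁ o))
    (prob (pOut p ends u) (avoidAll ends a₂ {a₁} ∩ connEvent ends a₂ o))
    (prob (pOut p ends u) (avoidAll ends a₂ {a₁} ∩ connEvent ends a₁ b))
    (prob (pOut p ends u) (avoidAll ends a₂ {a₁} ∩ connEvent ends a₂ b))
    (prob (pOut p ends u) (avoidAll ends a₂ {a₁} ∩ connEvent ends a₁ o ∩ connEvent ends a₂ b))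
    (prob (pOut p ends u) (avoidAll ends a₂ {a₁} ∩ connEvent ends a₁ o ∩ connEvent ends a₁ b))
    (prob (pOut p ends u) (avoidAll ends a₂ {a₁} ∩ connEvent ends a₂ o ∩ connEvent ends a₁ b))
    (prob (pOut p ends u) (avoidAll ends a₂ {a₁} ∩ connEvent ends a₂ o ∩ connEvent ends a₂ b))
    (prob (pOut p ends u) (avoidAll ends a₂ {a₁} ∩ (connEvent ends o a₁)ᶜ ∩ (connEvent ends o a₂)ᶜ ∩
    connEvent ends a₂ b))
    (cobMass (pOut p ends u) ends o a₁ a₂ b)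
    (PocketConn.Eprod' (pOut p ends u) ends o a₁ a₂ b)
    (PocketConn.Eprod' (pOut p ends u) ends o a₂ a₁ b)
    (termW p ends o a₁ a₂ b {u}) al be r

section Kappa

variable {p ends}
variable (hp : IsProbVec p) (hf : ends f = s(a₃, u)) (hf₁ : ends f₁ = s(u, a₁)) (hf₂ : ends f₂ = s(u, a₂))
  (hf₃ : ends f₃ = s(u, o)) (hleaf : ∀ e, a₃ ∈ ends e → e = f)
  (hstar : ∀ e, u ∈ ends e → e = f ∨ e = f₁ ∨ e = f₂ ∨ e = f₃) (h3u : a₃ ≠ u) {b : V}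
  (h3o : a₃ ≠ o) (h31 : a₃ ≠ a₁) (h32 : a₃ ≠ a₂) (h3b : a₃ ≠ b) (hu1 : u ≠ a₁) (hu2 : u ≠ a₂)
  (huo : u ≠ o) (hub : u ≠ b) (h12 : a₁ ≠ a₂) (h1o : a₁ ≠ o) (h2o : a₂ ≠ o)

include hp hf hf₁ hf₂ hf₃ hleaf hstar h3u h3o h31 h32 h3b hu1 hu2 huo hub h12 h1o h2o

/-- **The attachment coefficient of the class is `kappaMassO` of the class-O table at `u`** in the
loop graph `ends' = ends[f ↦ s(a₃, a₃)]`: `HMFLeafRB.kappa_eq`, the sure-edge relabelling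
`a₃ → u`, the invisibility of the unmarked leaf, the loop re-routing, and the class-O mass lemmas. -/
theorem kappa_star_eq :
    4 * HMFc (Function.update p f (1 / 2)) ends o a₁ a₂ a₃ b -
        2 * HMFc (Function.update p f 1) ends o a₁ a₂ a₃ b =
      kappaTable p (Function.update ends f s(a₃, a₃)) u o a₁ a₂ b (p f₁) (p f₂) (p f₃) := by
  unfold kappaTable
  rw [HMFLeafStep.kappa_eq p ends hp hf hleaf h3u h31 h32 h3o.symm h3b.symm]
  -- the loop graph and its star at `u`
  set ends' := Function.update ends f s(a₃, a₃) with hends'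
  obtain ⟨hf₁', hf₂', hf₃', hstar'⟩ := star_loop ends hf hf₁ hf₂ hf₃ hstar h3u h31 h32 h3o
  -- step 1: the sure edge relabels the mark `a₃ → u` in the contracted masses
  have hq1 : Function.update p f 1 f = 1 := by simp
  have hqp : IsProbVec (Function.update p f 1) := hp.update f zero_le_one le_rfl
  have hPD : ∀ X : Set (Config E), prob (Function.update p f 1) (PDEvent ends a₁ a₂ a₃ ∩ X) =
      prob (Function.update p f 1) (PDEvent ends a₁ a₂ u ∩ X) := fun X =>
    prob_eq_of_inter_open _ hqp hq1 (inter_open_congr (PD_inter_open hf a₁ a₂))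
  have hPDu : prob (Function.update p f 1) (PDEvent ends a₁ a₂ a₃) =
      prob (Function.update p f 1) (PDEvent ends a₁ a₂ u) :=
    prob_eq_of_inter_open _ hqp hq1 (PD_inter_open hf a₁ a₂)
  have hT : ∀ X : Set (Config E), prob (Function.update p f 1) (TEvent ends a₁ a₂ a₃ ∩ X) =
      prob (Function.update p f 1) (TEvent ends a₁ a₂ u ∩ X) := fun X =>
    prob_eq_of_inter_open _ hqp hq1 (inter_open_congr (T_inter_open hf a₁ a₂))
  have hTr : ∀ X : Set (Config E), prob (Function.update p f 1) (X ∩ TEvent ends a₁ a₂ a₃) =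
      prob (Function.update p f 1) (X ∩ TEvent ends a₁ a₂ u) := fun X =>
    prob_eq_of_inter_open _ hqp hq1 (inter_open_congr' (T_inter_open hf a₁ a₂))
  have hTu : prob (Function.update p f 1) (TEvent ends a₁ a₂ a₃) =
      prob (Function.update p f 1) (TEvent ends a₁ a₂ u) :=
    prob_eq_of_inter_open _ hqp hq1 (T_inter_open hf a₁ a₂)
  have hT' : ∀ X : Set (Config E), prob (Function.update p f 1) (TEvent ends a₂ a₁ a₃ ∩ X) =
      prob (Function.update p f 1) (TEvent ends a₂ a₁ u ∩ X) := fun X =>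
    prob_eq_of_inter_open _ hqp hq1 (inter_open_congr (T_inter_open hf a₂ a₁))
  have hT'u : prob (Function.update p f 1) (TEvent ends a₂ a₁ a₃) =
      prob (Function.update p f 1) (TEvent ends a₂ a₁ u) :=
    prob_eq_of_inter_open _ hqp hq1 (T_inter_open hf a₂ a₁)
  have hX : ∀ W : Finset V, prob (Function.update p f 1) (clusterEvent ends a₃ (↑W : Set V)) =
      prob (Function.update p f 1) (clusterEvent ends u (↑W : Set V)) := fun W =>
    prob_eq_of_inter_open _ hqp hq1 (cluster_inter_open hf (↑W : Set V))
  -- the mean field: relabel, drop the leaf, re-route to the loop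
  have hXhat : Xhat (Function.update p f 1) ends o a₁ a₂ a₃ b = Xhat p ends' o a₁ a₂ u b := by
    calc Xhat (Function.update p f 1) ends o a₁ a₂ a₃ b
        = Xhat (Function.update p f 1) ends o a₁ a₂ u b := by
          rw [Xhat_eq_sum, Xhat_eq_sum]
          exact Finset.sum_congr rfl fun W _ => by rw [hX W]
      _ = Xhat p ends o a₁ a₂ u b :=
          Xhat_update_leaf p hf hleaf h3u h3o h31 h32 h3u.symm h3b 1
      _ = Xhat (Function.update p f 0) ends o a₁ a₂ u b :=
          (Xhat_update_leaf p hf hleaf h3u h3o h31 h32 h3u.symm h3b 0).symm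
      _ = Xhat p ends' o a₁ a₂ u b := HMFLoop.Xhat_update_zero_eq_loop p ends f a₃ o a₁ a₂ u b
  simp only [CovForm.Do, massM2, deltaT, CovForm.EQ3, CovForm.EQ3o, hPD, hPDu, hT, hTr, hTu, hT',
    hT'u, hXhat]
  -- step 2: the unmarked leaf is invisible: every remaining mass is `f`-free
  have hc : ∀ v w : V, v ≠ a₃ → w ≠ a₃ → Free f (connEvent ends v w) := fun v w hv hw =>
    free_connEvent hf hleaf h3u hv hw
  have hQ : Free f (avoidAll ends a₂ {a₁}) := by
    rw [avoidAll_eq_compl]; exact (hc a₁ a₂ h31.symm h32.symm).compl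
  have hPDf : Free f (PDEvent ends a₁ a₂ u) := by
    unfold PDEvent Dtilde UnionCluster.inU
    exact (hc a₁ a₂ h31.symm h32.symm).compl.inter
      (free_union (hc u a₁ h3u.symm h31.symm) (hc u a₂ h3u.symm h32.symm)).compl
  have hTf : Free f (TEvent ends a₁ a₂ u) := by
    unfold TEvent
    exact (hc a₂ a₁ h32.symm h31.symm).compl.inter (hc a₂ u h32.symm h3u.symm)
  have hT'f : Free f (TEvent ends a₂ a₁ u) := by
    unfold TEvent
    exact (hc a₁ a₂ h31.symm h32.symm).compl.inter (hc a₁ u h31.symm h3u.symm)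
  have key : ∀ A : Set (Config E), Free f A →
      prob (Function.update p f 1) A = prob (Function.update p f 0) A := fun A hA => by
    rw [PendantEdm.prob_update_of_free p hA 1, PendantEdm.prob_update_of_free p hA 0]
  have key0 : ∀ A : Set (Config E), Free f A → prob p A = prob (Function.update p f 0) A :=
    fun A hA => (PendantEdm.prob_update_of_free p hA 0).symm
  simp only [key _ hPDf, key _ hTf, key _ hT'f,
    key _ (hPDf.inter (hc a₁ o h31.symm h3o.symm)), key _ (hPDf.inter (hc a₂ o h32.symm h3o.symm)),
    key _ (hPDf.inter (hc a₂ b h32.symm h3b.symm)),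
    key _ ((hc a₂ b h32.symm h3b.symm).inter hTf), key _ ((hc a₁ b h31.symm h3b.symm).inter hTf),
    key _ (hT'f.inter (hc a₁ o h31.symm h3o.symm)), key _ (hT'f.inter (hc a₂ o h32.symm h3o.symm)),
    key _ (hTf.inter (hc a₁ o h31.symm h3o.symm)), key _ (hTf.inter (hc a₂ o h32.symm h3o.symm)),
    key0 _ hQ, key0 _ (hQ.inter (hc a₁ o h31.symm h3o.symm)),
    key0 _ (hQ.inter (hc a₂ o h32.symm h3o.symm)), key0 _ (hQ.inter (hc a₂ b h32.symm h3b.symm)),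
    key0 _ (hQ.inter (hc a₁ b h31.symm h3b.symm))]
  -- step 3: pinned closed = the loop graph
  have hH : ∀ ω x z, Conn ends (Function.update ω f false) x z ↔ Conn ends' ω (id x) (id z) :=
    fun ω x z => conn_update_false_iff_loop ends f a₃ ω x z
  simp only [prob_update_zero_eq_preimage, Set.preimage_inter, preimage_PDEvent hH,
    preimage_TEvent hH, preimage_connEvent hH, preimage_avoidAll_singleton hH, id]
  -- step 4: the class-O masses at the star `{f₁, f₂, f₃}` of `u` in the loop graph
  obtain ⟨hf12, hf13, hf23⟩ := star_edges_ne ends' hf₁' hf₂' hf₃' h12 h1o h2o hu1 hu2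
  have hstar'' : ∀ e, u ∈ ends' e → e = f₂ ∨ e = f₁ ∨ e = f₃ := fun e he => by
    rcases hstar' e he with h | h | h
    · exact Or.inr (Or.inl h)
    · exact Or.inl h
    · exact Or.inr (Or.inr h)
  set q := pOut p ends' u with hq
  -- the table
  set Z1 := prob q (avoidAll ends' a₂ {a₁}) with hZ1
  set AL := prob q (avoidAll ends' a₂ {a₁} ∩ connEvent ends' a₁ o) with hAL
  set AH := prob q (avoidAll ends' a₂ {a₁} ∩ connEvent ends' a₂ o) with hAH
  set BL := prob q (avoidAll ends' a₂ {a₁} ∩ connEvent ends' a₁ b) with hBL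
  set BH := prob q (avoidAll ends' a₂ {a₁} ∩ connEvent ends' a₂ b) with hBH
  set PLH := prob q (avoidAll ends' a₂ {a₁} ∩ connEvent ends' a₁ o ∩ connEvent ends' a₂ b) with hPLH
  set PLL := prob q (avoidAll ends' a₂ {a₁} ∩ connEvent ends' a₁ o ∩ connEvent ends' a₁ b) with hPLL
  set PHL := prob q (avoidAll ends' a₂ {a₁} ∩ connEvent ends' a₂ o ∩ connEvent ends' a₁ b) with hPHL
  set PHH := prob q (avoidAll ends' a₂ {a₁} ∩ connEvent ends' a₂ o ∩ connEvent ends' a₂ b) with hPHH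
  set PNH := prob q (avoidAll ends' a₂ {a₁} ∩ (connEvent ends' o a₁)ᶜ ∩ (connEvent ends' o a₂)ᶜ ∩
    connEvent ends' a₂ b) with hPNH
  set cob := cobMass q ends' o a₁ a₂ b with hcob
  set Gob := PocketConn.Eprod' q ends' o a₁ a₂ b with hGob
  set Gpob := PocketConn.Eprod' q ends' o a₂ a₁ b with hGpob
  -- the masses
  have mQ := prob_Q_star p ends' hf₁' hf₂' hf₃' hstar' hu1 hu2 huo hf12 hf13 hf23
  have mD := prob_PD_star p ends' hf₁' hf₂' hf₃' hstar' hu1 hu2 huo hf12 hf13 hf23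
  rw [prob_Q_oN q ends' o a₁ a₂] at mD
  have mDoL := prob_PD_inter_conn_star p ends' hf₁' hf₂' hf₃' hstar' hu1 hu2 huo hf12 hf13 hf23
    (x := a₁) (y := o) hu1.symm huo.symm
  rw [prob_Q_oN_oL_zero q ends' o a₁ a₂, mul_zero, add_zero] at mDoL
  have mDoH := prob_PD_inter_conn_star p ends' hf₁' hf₂' hf₃' hstar' hu1 hu2 huo hf12 hf13 hf23
    (x := a₂) (y := o) hu2.symm huo.symm
  rw [prob_Q_oN_oH_zero q ends' o a₁ a₂, mul_zero, add_zero] at mDoH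
  have mM2 := prob_PD_inter_conn_star p ends' hf₁' hf₂' hf₃' hstar' hu1 hu2 huo hf12 hf13 hf23
    (x := a₂) (y := b) hu2.symm hub.symm
  -- T masses
  have mTbH := prob_T_inter_conn_star p ends' hf₁' hf₂' hf₃' hstar' hu1 hu2 huo hf12 hf13 hf23
    (x := a₂) (y := b) hu2.symm hub.symm
  rw [glue23_a2 ends' o a₂ b, prob_Q_not_oL_bH_union q ends' o a₁ a₂ b] at mTbH
  have mTbL := prob_T_inter_conn_star p ends' hf₁' hf₂' hf₃' hstar' hu1 hu2 huo hf12 hf13 hf23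
    (x := a₁) (y := b) hu1.symm hub.symm
  rw [Q_glue23_a1 ends' o a₁ a₂ b, prob_Q_not_oL q ends' o a₁ a₂ (connEvent ends' a₁ b)] at mTbL
  have mT := prob_T_inter_conn_star p ends' hf₁' hf₂' hf₃' hstar' hu1 hu2 huo hf12 hf13 hf23
    (x := a₂) (y := a₂) hu2.symm hu2.symm
  rw [glue23_a2 ends' o a₂ a₂, connEvent_self ends' a₂, Set.univ_union, Set.inter_univ, Set.inter_univ,
    Set.inter_univ, Set.inter_univ, prob_Q_not_oL_univ ends' q] at mT
  have mToL := prob_T_inter_conn_star p ends' hf₁' hf₂' hf₃' hstar' hu1 hu2 huo hf12 hf13 hf23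
    (x := a₁) (y := o) hu1.symm huo.symm
  rw [Q_glue23_a1 ends' o a₁ a₂ o, prob_Q_not_oL q ends' o a₁ a₂ (connEvent ends' a₁ o),
    inter_conn_self, sub_self, mul_zero, add_zero, Q_oH_oL_empty (o := o) (a₁ := a₁) (a₂ := a₂) ends', prob_empty, mul_zero,
    add_zero] at mToL
  have mToH := prob_T_inter_conn_star p ends' hf₁' hf₂' hf₃' hstar' hu1 hu2 huo hf12 hf13 hf23
    (x := a₂) (y := o) hu2.symm huo.symm
  rw [glue23_a2 ends' o a₂ o, connEvent_self ends' o, Set.union_univ, Set.inter_univ,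
    prob_Q_not_oL_univ ends' q, inter_conn_self] at mToH
  -- T′ masses (roots swapped)
  have mTpoL := prob_T_inter_conn_star p ends' (f₁ := f₂) (f₂ := f₁) (a₁ := a₂) (a₂ := a₁) hf₂' hf₁' hf₃'
    hstar'' hu2 hu1 huo hf12.symm hf23 hf13 (x := a₁) (y := o) hu1.symm huo.symm
  rw [avoidAll_swap, glue23_eq_glue13, connEvent_comm ends' o a₂, glue13_a1 ends' o a₁ o,
    connEvent_self ends' o, Set.union_univ, Set.inter_univ, prob_Q_not_oH_univ ends' q,
    inter_conn_self] at mTpoL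
  have mTpoH := prob_T_inter_conn_star p ends' (f₁ := f₂) (f₂ := f₁) (a₁ := a₂) (a₂ := a₁) hf₂' hf₁' hf₃'
    hstar'' hu2 hu1 huo hf12.symm hf23 hf13 (x := a₂) (y := o) hu2.symm huo.symm
  rw [avoidAll_swap, glue23_eq_glue13, connEvent_comm ends' o a₂, Q_glue13_a2 ends' o a₁ a₂ o,
    prob_Q_not_oH q ends' o a₁ a₂ (connEvent ends' a₂ o), inter_conn_self, sub_self, mul_zero,
    add_zero, Q_oL_oH_empty ends' o a₁ a₂, prob_empty, mul_zero, add_zero] at mTpoH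
  have mTp := prob_T_inter_conn_star p ends' (f₁ := f₂) (f₂ := f₁) (a₁ := a₂) (a₂ := a₁) hf₂' hf₁' hf₃'
    hstar'' hu2 hu1 huo hf12.symm hf23 hf13 (x := a₁) (y := a₁) hu1.symm hu1.symm
  rw [avoidAll_swap, glue23_eq_glue13, connEvent_comm ends' o a₂, glue13_a1 ends' o a₁ a₁,
    connEvent_self ends' a₁, Set.univ_union, Set.inter_univ, Set.inter_univ, Set.inter_univ,
    Set.inter_univ, prob_Q_not_oH_univ ends' q] at mTp
  -- Q masses with a connection
  have mQoL := prob_Q_inter_conn_star p ends' hf₁' hf₂' hf₃' hstar' hu1 hu2 huo hf12 hf13 hf23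
    (x := a₁) (y := o) hu1.symm huo.symm
  rw [glue13_a1 ends' o a₁ o, connEvent_self ends' o, Set.union_univ, Set.inter_univ,
    prob_Q_not_oH_univ ends' q, Q_glue23_a1 ends' o a₁ a₂ o,
    prob_Q_not_oL q ends' o a₁ a₂ (connEvent ends' a₁ o), inter_conn_self, sub_self, mul_zero,
    add_zero] at mQoL
  have mQoH := prob_Q_inter_conn_star p ends' hf₁' hf₂' hf₃' hstar' hu1 hu2 huo hf12 hf13 hf23
    (x := a₂) (y := o) hu2.symm huo.symm
  rw [Q_glue13_a2 ends' o a₁ a₂ o, prob_Q_not_oH q ends' o a₁ a₂ (connEvent ends' a₂ o),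
    inter_conn_self, sub_self, mul_zero, add_zero, glue23_a2 ends' o a₂ o, connEvent_self ends' o,
    Set.union_univ, Set.inter_univ, prob_Q_not_oL_univ ends' q] at mQoH
  have mQbH := prob_Q_inter_conn_star p ends' hf₁' hf₂' hf₃' hstar' hu1 hu2 huo hf12 hf13 hf23
    (x := a₂) (y := b) hu2.symm hub.symm
  rw [Q_glue13_a2 ends' o a₁ a₂ b, prob_Q_not_oH q ends' o a₁ a₂ (connEvent ends' a₂ b),
    glue23_a2 ends' o a₂ b, prob_Q_not_oL_bH_union q ends' o a₁ a₂ b] at mQbH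
  have mQbL := prob_Q_inter_conn_star p ends' hf₁' hf₂' hf₃' hstar' hu1 hu2 huo hf12 hf13 hf23
    (x := a₁) (y := b) hu1.symm hub.symm
  rw [glue13_a1 ends' o a₁ b, prob_Q_not_oH_bL_union q ends' o a₁ a₂ b, Q_glue23_a1 ends' o a₁ a₂ b,
    prob_Q_not_oL q ends' o a₁ a₂ (connEvent ends' a₁ b)] at mQbL
  -- the mean field
  have mX := Xhat_star3 p ends' hf₁' hf₂' hf₃' hstar' hu1 hu2 huo hub hf12 hf13 hf23
  have hheavy : heavySum ends' q o a₁ a₂ b = PLH - Gob := by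
    unfold heavySum
    rw [PocketConn.sum_T_eq_expect q ends' o a₁ a₂ b, PocketConn.expect_FT]
    congr 2
    ext ω
    simp only [Set.mem_inter_iff, mem_connEvent, Set.mem_compl_iff, avoidAll_eq_compl]
    constructor
    · rintro ⟨⟨h2b, h1o⟩, hQ⟩; exact ⟨⟨fun h => hQ (conn_symm h), h1o⟩, h2b⟩
    · rintro ⟨⟨hQ, h1o⟩, h2b⟩; exact ⟨⟨h2b, h1o⟩, fun h => hQ (conn_symm h)⟩
  have hlight : lightSum ends' q o a₁ a₂ b = PHL - Gpob := by
    unfold lightSum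
    rw [PocketConn.sum_T_eq_expect q ends' o a₂ a₁ b, PocketConn.expect_FT]
    congr 2
    ext ω
    simp only [Set.mem_inter_iff, mem_connEvent, Set.mem_compl_iff, avoidAll_eq_compl]
    constructor
    · rintro ⟨⟨h1b, h2o⟩, hQ⟩; exact ⟨⟨hQ, h2o⟩, h1b⟩
    · rintro ⟨⟨hQ, h2o⟩, h1b⟩; exact ⟨⟨h1b, h2o⟩, hQ⟩
  -- assemble
  have eT1 : connEvent ends' a₂ b ∩ TEvent ends' a₁ a₂ u = TEvent ends' a₁ a₂ u ∩ connEvent ends' a₂ b :=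
    Set.inter_comm _ _
  have eT2 : connEvent ends' a₁ b ∩ TEvent ends' a₁ a₂ u = TEvent ends' a₁ a₂ u ∩ connEvent ends' a₁ b :=
    Set.inter_comm _ _
  rw [eT1, eT2]
  rw [mQ]
  rw [mD]
  rw [mDoL, mDoH]
  rw [mM2]
  rw [mTbH, mTbL]
  rw [mT]
  rw [mToL, mToH]
  rw [mTp]
  rw [mTpoL, mTpoH]
  rw [mQoL, mQoH]
  rw [mQbH, mQbL]
  rw [mX, hheavy, hlight]
  unfold kappaMassO qoLMass qoHMass qbHMass qbLMass zMass dMass doMass wMass xhatMass eq3Mass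
    eq3oMass
  ring

/-- **(HMF) on the class «a₃ pendant at u, N(u) = {a₁, a₂, o, a₃}» from the sign of the attachment
coefficient**: hypothesis (i) of the leaf step is `HMF_contract_star_o`, hypothesis (ii) is
`kappa_star_eq` together with `0 ≤ kappaMassO (table)` (the κ-certificate of the class-O table). -/
theorem HMF_star_leaf_o_of_kappa
    (hk : 0 ≤ kappaTable p (Function.update ends f s(a₃, a₃)) u o a₁ a₂ b (p f₁) (p f₂) (p f₃)) :
    HMF p ends o a₁ a₂ a₃ b := by
  have hrel := HMFSureEdge.HMFc_relabel_of_sure (Function.update p f 1) ends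
    (hp.update f zero_le_one le_rfl) hf (by simp) o a₁ a₂ b
  refine HMFLeafStep.HMF_of_leaf_step p ends hp hf hleaf h3u h31 h32 h3o.symm h3b.symm ?_ ?_
  · rw [hrel]
    exact HMF_contract_star_o p ends hp hf hf₁ hf₂ hf₃ hleaf hstar h3u h3o h31 h32 h3b hu1 hu2 huo
      hub h12 h1o h2o
  · rw [kappa_star_eq hp hf hf₁ hf₂ hf₃ hleaf hstar h3u h3o h31 h32 h3b hu1 hu2 huo hub h12 h1o h2o]
    exact hk

end Kappa

end HMFStarLeafO

end Summit.Ventures.PercRepro2
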